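/-
Copyright (c) 2026. Released under Apache 2.0 license.

# CDT Corollary 4.5.3: reduction of the input `hcor` to `SL₂(ℤ)`-invariant characters

The assembled form of [CalegariDimitrovTang2025, Theorem 1.0.1]
(`CalegariDimitrovTang2025_unboundedDenominators.of_printed_inputs'''`) takes Corollary 4.5.3 as the
hypothesis `hcor`: a homomorphism `θ : Γ(N) → Q` to a finite abelian group all of whose conjugation
defects `x ↦ θ(g x g⁻¹) θ(x)⁻¹` (`g ∈ SL₂(ℤ)`) have congruence kernels has itself a congruence
kernel.  Since `SL₂(ℤ) = ⟨S, T⟩`, the defects of `S` and `T` control all others on a common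
principal congruence subgroup `Γ(N')`, on which `θ` becomes honestly `SL₂(ℤ)`-invariant.  Hence
`hcor` follows from its **invariant form** — *an `SL₂(ℤ)`-conjugation-invariant homomorphism from
`Γ(N)` to a finite abelian group is trivial on some `Γ(M)`* — which is the statement CDT deduce
from their cohomological Theorem 4.5.2 (`H̃¹(𝐅_ℓ)^{SL₂(ℤ̂)} = 0`); equivalently: every finite
central extension of `SL₂(ℤ/N)` realised as a quotient of `SL₂(ℤ)` is a congruence quotient.
-/
import Mathlib.NumberTheory.ModularForms.CongruenceSubgroups
import Mathlib.LinearAlgebra.Matrix.FixedDetMatrices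
import HarnessLib

open scoped MatrixGroups

namespace Literature.NumberTheory.Automorphic

namespace UnboundedDenominators

open CongruenceSubgroup Matrix.SpecialLinearGroup ModularGroup

/-! ### `hcor` from the invariant form of Corollary 4.5.3 -/

/-- `Γ(N') ≤ Γ(N)` for `N ∣ N'`. [folklore] -/
private theorem Gamma_antitone_of_dvd {N N' : ℕ} (h : N ∣ N') : Gamma N' ≤ Gamma N := by
  intro A hA
  rw [Gamma_mem] at hA ⊢
  obtain ⟨h00, h01, h10, h11⟩ := hA
  have c00 := congrArg (ZMod.castHom h (ZMod N)) h00
  have c01 := congrArg (ZMod.castHom h (ZMod N)) h01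
  have c10 := congrArg (ZMod.castHom h (ZMod N)) h10
  have c11 := congrArg (ZMod.castHom h (ZMod N)) h11
  rw [map_intCast, map_one] at c00 c11
  rw [map_intCast, map_zero] at c01 c10
  exact ⟨c00, c01, c10, c11⟩

/-- **CDT Corollary 4.5.3, reduction to the invariant form.**  Suppose that for every `N`, every
homomorphism `θ : Γ(N) → Q` to a finite abelian group which is invariant under conjugation by all
of `SL₂(ℤ)` is trivial on some principal congruence subgroup `Γ(M)`, `M ≠ 0`.  Then the hypothesis
`hcor` of `CalegariDimitrovTang2025_unboundedDenominators.of_printed_inputs'''` holds: if each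
conjugation defect `x ↦ θ(gxg⁻¹)θ(x)⁻¹`, `g ∈ SL₂(ℤ)`, is trivial on some `Γ(M_g)`, then `θ` is
trivial on some `Γ(M)` (use `SL₂(ℤ) = ⟨S, T⟩` to pass to `Γ(N·M_S·M_T)`, where `θ` is invariant).
[cite: CalegariDimitrovTang2025, Corollary 4.5.3 and Lemma 4.6.3] -/
theorem cor453_of_invariant_form
    (hinv : ∀ (N : ℕ) (Q : Type) [CommGroup Q] [Finite Q] (θ : Gamma N →* Q),
      (∀ (g x : SL(2, ℤ)) (hx : x ∈ Gamma N) (hgx : g * x * g⁻¹ ∈ Gamma N),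
        θ ⟨g * x * g⁻¹, hgx⟩ = θ ⟨x, hx⟩) →
      ∃ M : ℕ, M ≠ 0 ∧ ∀ (x : SL(2, ℤ)) (hx : x ∈ Gamma N), x ∈ Gamma M → θ ⟨x, hx⟩ = 1)
    (N : ℕ) (Q : Type) [CommGroup Q] [Finite Q] (θ : Gamma N →* Q)
    (hθ : ∀ g : SL(2, ℤ), ∃ M : ℕ, M ≠ 0 ∧ ∀ (x : SL(2, ℤ)) (hx : x ∈ Gamma N)
      (hgx : g * x * g⁻¹ ∈ Gamma N), x ∈ Gamma M → θ ⟨g * x * g⁻¹, hgx⟩ = θ ⟨x, hx⟩) :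
    ∃ M : ℕ, M ≠ 0 ∧ ∀ (x : SL(2, ℤ)) (hx : x ∈ Gamma N), x ∈ Gamma M → θ ⟨x, hx⟩ = 1 := by
  classical
  -- the degenerate level `N = 0`: `Γ(0)` is trivial
  rcases Nat.eq_zero_or_pos N with hN0 | hNpos
  · subst hN0
    refine ⟨1, one_ne_zero, fun x hx _ ↦ ?_⟩
    have hx1 : x = 1 := by simpa [Gamma_zero_bot] using hx
    have : (⟨x, hx⟩ : Gamma 0) = 1 := Subtype.ext hx1
    rw [this, map_one]
  -- the conjugate of an element of `Γ(N)` lies in `Γ(N)`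
  have hconj : ∀ (g x : SL(2, ℤ)), x ∈ Gamma N → g * x * g⁻¹ ∈ Gamma N :=
    fun g x hx ↦ (Gamma_normal N).conj_mem x hx g
  obtain ⟨MS, hMS, hS⟩ := hθ S
  obtain ⟨MT, hMT, hT⟩ := hθ T
  -- the common level `N' = N · M_S · M_T`
  set N' : ℕ := N * MS * MT with hN'
  have hN'N : Gamma N' ≤ Gamma N := Gamma_antitone_of_dvd ⟨MS * MT, by rw [hN']; ring⟩
  have hN'S : Gamma N' ≤ Gamma MS := Gamma_antitone_of_dvd ⟨N * MT, by rw [hN']; ring⟩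
  have hN'T : Gamma N' ≤ Gamma MT := Gamma_antitone_of_dvd ⟨N * MS, by rw [hN']; ring⟩
  -- the set of `g` whose defect vanishes on `Γ(N')` is a subgroup containing `S` and `T`
  set H : Subgroup SL(2, ℤ) :=
    { carrier := {g | ∀ (x : SL(2, ℤ)) (hx : x ∈ Gamma N'),
        θ ⟨g * x * g⁻¹, hconj g x (hN'N hx)⟩ = θ ⟨x, hN'N hx⟩}
      mul_mem' := by
        intro a b ha hb x hx
        have hbx : b * x * b⁻¹ ∈ Gamma N' := (Gamma_normal N').conj_mem x hx b
        have h1 : θ ⟨a * (b * x * b⁻¹) * a⁻¹, _⟩ = θ ⟨b * x * b⁻¹, _⟩ := ha (b * x * b⁻¹) hbx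
        have h2 : θ ⟨b * x * b⁻¹, _⟩ = θ ⟨x, _⟩ := hb x hx
        show θ ⟨a * b * x * (a * b)⁻¹, _⟩ = θ ⟨x, _⟩
        rw [← h2, ← h1]
        congr 1
        exact Subtype.ext (by simp only [mul_inv_rev, mul_assoc])
      one_mem' := by
        intro x hx
        show θ ⟨1 * x * 1⁻¹, _⟩ = θ ⟨x, _⟩
        congr 1
        exact Subtype.ext (by simp)
      inv_mem' := by
        intro a ha x hx
        have hax : a⁻¹ * x * a⁻¹⁻¹ ∈ Gamma N' := (Gamma_normal N').conj_mem x hx a⁻¹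
        have h1 : θ ⟨a * (a⁻¹ * x * a⁻¹⁻¹) * a⁻¹, _⟩ = θ ⟨a⁻¹ * x * a⁻¹⁻¹, _⟩ :=
          ha (a⁻¹ * x * a⁻¹⁻¹) hax
        show θ ⟨a⁻¹ * x * a⁻¹⁻¹, _⟩ = θ ⟨x, _⟩
        rw [← h1]
        congr 1
        exact Subtype.ext (by simp [mul_assoc]) } with hH
  have hSH : S ∈ H := fun x hx ↦ hS x (hN'N hx) (hconj S x (hN'N hx)) (hN'S hx)
  have hTH : T ∈ H := fun x hx ↦ hT x (hN'N hx) (hconj T x (hN'N hx)) (hN'T hx)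
  have hHtop : H = ⊤ := by
    rw [eq_top_iff, ← SpecialLinearGroup.SL2Z_generators, Subgroup.closure_le]
    intro g hg
    rcases hg with rfl | rfl
    · exact hSH
    · exact hTH
  -- restrict `θ` to `Γ(N')`, where it is invariant
  set θ' : Gamma N' →* Q := θ.comp (Subgroup.inclusion hN'N) with hθ'
  have hθ'apply : ∀ (x : SL(2, ℤ)) (hx : x ∈ Gamma N'), θ' ⟨x, hx⟩ = θ ⟨x, hN'N hx⟩ :=
    fun x hx ↦ rfl
  have hθ'inv : ∀ (g x : SL(2, ℤ)) (hx : x ∈ Gamma N') (hgx : g * x * g⁻¹ ∈ Gamma N'),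
      θ' ⟨g * x * g⁻¹, hgx⟩ = θ' ⟨x, hx⟩ := by
    intro g x hx hgx
    have hg : g ∈ H := by rw [hHtop]; exact Subgroup.mem_top g
    rw [hθ'apply, hθ'apply]
    exact hg x hx
  obtain ⟨M, hM, hker⟩ := hinv N' Q θ' hθ'inv
  have hN'0 : N' ≠ 0 := by
    rw [hN']
    exact Nat.mul_ne_zero (Nat.mul_ne_zero hNpos.ne' hMS) hMT
  refine ⟨N' * M, Nat.mul_ne_zero hN'0 hM, fun x hx hxM ↦ ?_⟩
  have hxN' : x ∈ Gamma N' := Gamma_antitone_of_dvd (dvd_mul_right N' M) hxM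
  have hxM' : x ∈ Gamma M := Gamma_antitone_of_dvd (dvd_mul_left M N') hxM
  rw [← hker x hxN' hxM', hθ'apply]

end UnboundedDenominators

end Literature.NumberTheory.Automorphic
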